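import Mathlib
import HarnessLib
import Literature.Analysis.FluidPDE.TypeIAncientMild
import Literature.Analysis.FluidPDE.MildSolution
import Summits.NavierStokesRegularity.NavierStokesRegularity.Theorems.QuarterLogPincerQuietCollarDefs
import Summits.NavierStokesRegularity.NavierStokesRegularity.Theorems.QuarterLogPincerQuietCollarCutReference
import Summits.NavierStokesRegularity.NavierStokesRegularity.Theorems.QuarterLogPincerQuietCollarDefectRestart
import Summits.NavierStokesRegularity.NavierStokesRegularity.Theorems.QuarterLogPincerQuietCollarHeatCommutator
import Summits.NavierStokesRegularity.NavierStokesRegularity.Theorems.QuarterLogPincerQuietCollarHeatCommutatorL3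
import Summits.NavierStokesRegularity.NavierStokesRegularity.Theorems.QuarterLogPincerQuietCollarOseenCommutatorSup
import Summits.NavierStokesRegularity.NavierStokesRegularity.Theorems.QuarterLogPincerQuietCollarOseenCommutatorL3
import Summits.NavierStokesRegularity.NavierStokesRegularity.Theorems.QuarterLogPincerTruncationEdgeOseenStability

/-!
# Route `QuarterLogPincer`, crux `TypeIQuantSubcubicExp` (stmt-NavierStokesRegularity-24077), line `quiet_collar` — towards QP2
# (log-weighted typing `StubCutPairLog`), module E: THE MILD DEFECT OF THE CUT REFERENCE — SUP AND `L³` BOUNDS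

For a Type-I ancient mild field `v` (rate `M`), a radius `r ≥ 0`, a collar width `L ≥ 1`, `ε ∈ (0,1/2]`, a radius factor
`Λ ≥ 1`, the cut reference `V(t) = χ·v(t−1)` (`χ = radialCutoff r (r+L)`) on the slab `[0, 1−ε]`, and the radius
`R = 2Λ(r+L)²`: if `v` is `η_c`-quiet on the collar for `s ∈ [−1,−ε]` and `‖1_{B(0,R)}v(s)‖₃ ≤ b` there, then for every
`t ∈ [0, 1−ε]`

* SUP: `‖mildDefect V t x‖ ≤ C·(M/L + (M²/ε)·L^{−1/2} + η_c²)` — heat commutator (`…QuietCollarHeatCommutator`) + Oseen commutator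
  (`…QuietCollarOseenCommutatorSup`), the two pieces of `…QuietCollarCutReference.mildDefect_cutRef_eq`;
* `L³`: `‖mildDefect V t‖₃ ≤ C·((M+1)·b + η_c·b + M + M²/(εΛ))` — `…QuietCollarHeatCommutatorL3` and `…QuietCollarOseenCommutatorL3`
  against the LOCAL budget `b`, the tails absorbed by `R − (r+L) ≥ Λ(r+L)²`.

`exists_mildDefect_cutRef_bounds` packages both with ONE absolute constant `C`.  HONEST FRAME: estimates about a hypothetical Type-I
field; nothing here bears on 24077, W7 or Navier–Stokes regularity (OPEN).  pub-ns-dss typer (g37), `--supports 24077`.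
-/

noncomputable section

set_option linter.dupNamespace false

namespace Summit.NavierStokesRegularity.NavierStokesRegularity.Cruxes.TypeIQuantSubcubicExp.QuietCollar

open MeasureTheory Set Function Filter Real Metric
open scoped ENNReal NNReal Topology
open Literature.Analysis Literature.Analysis.FluidPDE Literature.Analysis.UnboundedOperators
open Summit.NavierStokesRegularity.NavierStokesRegularity.Theorems.QuarterLogPincerTruncationEdge

/-- Continuity of the shifted field `(τ, y) ↦ v(τ−1, y)` on the slab `[0, 1−ε] × ℝ³` (`ε > 0`). [folklore] -/
theorem continuousOn_shift {M : ℝ} {v : ℝ → EuclideanSpace ℝ (Fin 3) → EuclideanSpace ℝ (Fin 3)} (hv : IsTypeIAncientMild M v)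
    {ε : ℝ} (hε : 0 < ε) :
    ContinuousOn (uncurry fun τ y => v (τ - 1) y) (Set.Icc 0 (1 - ε) ×ˢ Set.univ) := by
  have h1 : ContinuousOn (fun p : ℝ × EuclideanSpace ℝ (Fin 3) => uncurry v (p.1 - 1, p.2)) (Set.Icc 0 (1 - ε) ×ˢ Set.univ) := by
    refine hv.continuousOn_uncurry.comp ((continuous_fst.sub continuous_const).prodMk continuous_snd).continuousOn ?_
    intro p hp
    exact ⟨by simp only [mem_Iio]; linarith [(mem_prod.1 hp).1.2], mem_univ _⟩
  exact h1

set_option maxHeartbeats 1200000 in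
/-- **THE MILD DEFECT OF THE CUT REFERENCE: SUP AND `L³` BOUNDS.** There is an absolute `C > 0` such that for every Type-I
ancient mild field `v` with rate `M`, all `r ≥ 0`, `L ≥ 1`, `ε ∈ (0,1/2]`, `Λ ≥ 1`, `η_c ≥ 0`, `b ≥ 0`, with `v` `η_c`-quiet on
the collar `{r ≤ |x| ≤ r+L}` for `s ∈ [−1,−ε]` and `‖1_{B(0,R)}v(s)‖₃ ≤ b` there (`R = 2Λ(r+L)²`), the cut reference
`V(t,x) = radialCutoff r (r+L) x • v(t−1,x)` satisfies for every `t ∈ [0,1−ε]`: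
`‖mildDefect V t x‖ ≤ C(M/L + (M²/ε)L^{−1/2} + η_c²)` for all `x`, and
`‖mildDefect V t‖_{L³} ≤ C((M+1)b + η_c b + M + M²/(εΛ))`. [folklore] -/
theorem exists_mildDefect_cutRef_bounds :
    ∃ C : ℝ, 0 < C ∧ ∀ (M : ℝ) (v : ℝ → EuclideanSpace ℝ (Fin 3) → EuclideanSpace ℝ (Fin 3)), IsTypeIAncientMild M v →
      ∀ (r L ε Λ ηc b : ℝ), 0 ≤ r → 1 ≤ L → ε ∈ Set.Ioc (0 : ℝ) (1 / 2) → 1 ≤ Λ → 0 ≤ ηc → 0 ≤ b →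
      (∀ s ∈ Set.Icc (-1 : ℝ) (-ε), ∀ x : EuclideanSpace ℝ (Fin 3), r ≤ ‖x‖ → ‖x‖ ≤ r + L → ‖v s x‖ ≤ ηc) →
      (∀ s ∈ Set.Icc (-1 : ℝ) (-ε),
        eLpNorm ((Metric.ball (0 : EuclideanSpace ℝ (Fin 3)) (2 * (Λ * (r + L) ^ 2))).indicator (v s)) 3 volume ≤
          ENNReal.ofReal b) →
      ∀ t ∈ Set.Icc 0 (1 - ε),
        (∀ x, ‖mildDefect (fun t x => radialCutoff r (r + L) x • v (t - 1) x) t x‖ ≤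
            C * (M / L + M ^ 2 / ε * L ^ (-(1 / 2 : ℝ)) + ηc ^ 2)) ∧
        eLpNorm (mildDefect (fun t x => radialCutoff r (r + L) x • v (t - 1) x) t) 3 volume ≤
          ENNReal.ofReal (C * ((M + 1) * b + ηc * b + M + M ^ 2 / (ε * Λ))) := by
  obtain ⟨C₁, hC₁, hheat⟩ := exists_norm_heatFlow_commutator_radialCutoff_le
  obtain ⟨C₁', hC₁', hLip⟩ := exists_abs_radialCutoff_sub_le
  obtain ⟨C₀, hC₀, hOsup⟩ := norm_oseenCommutator_le
  obtain ⟨C₀', hC₀', hOL3⟩ := eLpNorm_oseenCommutator_three_le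
  -- geometric constants
  set m₁ : ℝ := 2 * (2 : ℝ) ^ ((Module.finrank ℝ (EuclideanSpace ℝ (Fin 3)) : ℝ) / 2) with hm₁
  have hm₁pos : 0 < m₁ := by positivity
  set vB : ℝ := ((volume (Metric.ball (0 : EuclideanSpace ℝ (Fin 3)) 1)) ^ (1 / (3 : ℝ))).toReal with hvB
  set vC : ℝ := ((volume (Metric.ball (0 : EuclideanSpace ℝ (Fin 3)) 1)) ^ (1 / (3 : ℝ))).toReal with hvC
  have hvB0 : 0 ≤ vB := ENNReal.toReal_nonneg
  have hvC0 : 0 ≤ vC := ENNReal.toReal_nonneg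
  set CK : ℝ := oseenKernelBoundConst (EuclideanSpace ℝ (Fin 3)) with hCK
  have hCKpos : 0 < CK := oseenKernelBoundConst_pos
  -- THE constant
  set C : ℝ := C₁ * m₁ + C₀ * (C₁' ^ (1 / 2 : ℝ) + 1) + 2 + m₁ * vC + C₀' * (C₁' ^ (1 / 2 : ℝ) + 1) + CK * 4 * Real.pi * vB + 1
    with hC
  have hC₁'h : 0 ≤ C₁' ^ (1 / 2 : ℝ) := Real.rpow_nonneg hC₁'.le _
  have hna : 0 ≤ C₁ * m₁ := by positivity
  have hnb : 0 ≤ C₀ * C₁' ^ (1 / 2 : ℝ) := by positivity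
  have hnc : 0 ≤ m₁ * vC := by positivity
  have hnd : 0 ≤ C₀' * C₁' ^ (1 / 2 : ℝ) := by positivity
  have hne : 0 ≤ CK * 4 * Real.pi * vB := by positivity
  have hCexp : C = C₁ * m₁ + (C₀ * C₁' ^ (1 / 2 : ℝ) + C₀) + 2 + m₁ * vC + (C₀' * C₁' ^ (1 / 2 : ℝ) + C₀') +
      CK * 4 * Real.pi * vB + 1 := by rw [hC]; ring
  have hc1 : C₁ * m₁ ≤ C := by rw [hCexp]; linarith [hC₀.le, hC₀'.le]
  have hc2 : C₀ * C₁' ^ (1 / 2 : ℝ) ≤ C := by rw [hCexp]; linarith [hC₀.le, hC₀'.le]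
  have hc3 : C₀ ≤ C := by rw [hCexp]; linarith [hC₀'.le]
  have hc4 : (2 : ℝ) ≤ C := by rw [hCexp]; linarith [hC₀.le, hC₀'.le]
  have hc5 : m₁ * vC ≤ C := by rw [hCexp]; linarith [hC₀.le, hC₀'.le]
  have hc6 : C₀' * C₁' ^ (1 / 2 : ℝ) ≤ C := by rw [hCexp]; linarith [hC₀.le, hC₀'.le]
  have hc7 : C₀' ≤ C := by rw [hCexp]; linarith [hC₀.le]
  have hc8 : CK * 4 * Real.pi * vB ≤ C := by rw [hCexp]; linarith [hC₀.le, hC₀'.le]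
  have hCpos : 0 < C := by linarith
  refine ⟨C, hCpos, ?_⟩
  intro M v hv r L ε Λ ηc b hr hL hε hΛ hηc hb hquiet hbud t ht
  have hM : 0 ≤ M := hv.nonneg
  have hεpos : 0 < ε := hε.1
  have hε1 : ε < 1 := by linarith [hε.2]
  have hL0 : 0 < L := by linarith
  have hrL : 0 < r + L := by linarith
  have hrL1 : 1 ≤ r + L := by linarith
  have hrLR : r < r + L := by linarith
  set R : ℝ := 2 * (Λ * (r + L) ^ 2) with hR
  have hRgap : Λ * (r + L) ^ 2 ≤ R - (r + L) := by
    rw [hR]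
    have : r + L ≤ Λ * (r + L) ^ 2 := by nlinarith
    linarith
  have hRgap_pos : 0 < R - (r + L) := lt_of_lt_of_le (by positivity) hRgap
  have hRgt : r + L < R := by linarith
  set χ : EuclideanSpace ℝ (Fin 3) → ℝ := radialCutoff r (r + L) with hχdef
  set u : ℝ → EuclideanSpace ℝ (Fin 3) → EuclideanSpace ℝ (Fin 3) := fun τ y => v (τ - 1) y with hudef
  -- the case `t = 0`
  rcases eq_or_lt_of_le ht.1 with ht0 | ht0
  · rw [← ht0]
    have hz : mildDefect (fun t x => radialCutoff r (r + L) x • v (t - 1) x) 0 = 0 := by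
      funext x; exact mildDefect_zero _ x
    rw [hz]
    refine ⟨fun x => ?_, ?_⟩
    · simp only [Pi.zero_apply, norm_zero]; positivity
    · simp only [eLpNorm_zero]; exact bot_le
  -- `0 < t ≤ 1 − ε < 1`
  have ht1 : t < 1 := by linarith [ht.2]
  have htle1 : t ≤ 1 := ht1.le
  -- basic facts about `u = v(·−1)` on the slab
  have hu_cont : ContinuousOn (uncurry u) (Set.Icc 0 (1 - ε) ×ˢ Set.univ) := continuousOn_shift hv hεpos
  have hu_meas : AEStronglyMeasurable (uncurry u) (volume.restrict (Ioo 0 t ×ˢ univ)) :=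
    aestronglyMeasurable_of_continuousOn_slab hu_cont le_rfl ht.2
  have hA : ∀ τ ∈ Ioo 0 t, ∀ y, ‖u τ y‖ ≤ M / Real.sqrt ε := by
    intro τ hτ y
    have h := hv.norm_le (t := τ - 1) (by linarith [hτ.2]) y
    have hneg : -(τ - 1) = 1 - τ := by ring
    rw [hneg] at h
    refine h.trans (div_le_div_of_nonneg_left hM (Real.sqrt_pos.2 hεpos) (Real.sqrt_le_sqrt (by linarith [hτ.2, ht.2])))
  have hshape : ∀ τ ∈ Ioo 0 t, ∀ y, ‖u τ y‖ ≤ M * (1 - τ) ^ (-(1 / 2 : ℝ)) := by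
    intro τ hτ y
    have h := hv.norm_le (t := τ - 1) (by linarith [hτ.2]) y
    have hneg : -(τ - 1) = 1 - τ := by ring
    have h1τ : 0 < 1 - τ := by linarith [hτ.2]
    rw [hneg, Real.sqrt_eq_rpow, div_eq_mul_inv, ← Real.rpow_neg h1τ.le] at h
    exact h
  -- the cut-off: `[0,1]`-valued, measurable, Lipschitz `C₁'/L`, vanishing off `B(0,r+L)`, transition inside the collar
  have hχm : Measurable χ := (radialCutoff_contDiff r (r + L) (n := 0)).continuous.measurable
  have hχ0 : ∀ z, 0 ≤ χ z := fun z => radialCutoff_nonneg _ _ _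
  have hχ1 : ∀ z, χ z ≤ 1 := fun z => radialCutoff_le_one _ _ _
  have hχLip : ∀ x y, |χ x - χ y| ≤ C₁' / L * ‖x - y‖ := by
    intro x y
    have h := hLip r (r + L) hr hrLR x y
    rw [Real.norm_eq_abs, show r + L - r = L by ring] at h
    exact h
  have hχρ : ∀ z : EuclideanSpace ℝ (Fin 3), r + L ≤ ‖z‖ → χ z = 0 := fun z hz => radialCutoff_eq_zero hr hrLR hz
  have hlayer : ∀ τ ∈ Ioo 0 t, ∀ y, 0 < χ y → χ y < 1 → ‖u τ y‖ ≤ ηc := by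
    intro τ hτ y hy0 hy1
    have hy_gt : r < ‖y‖ := by
      by_contra hcon
      exact (ne_of_lt hy1) (radialCutoff_eq_one hr hrLR (not_lt.1 hcon))
    have hy_lt : ‖y‖ < r + L := by
      by_contra hcon
      exact (ne_of_gt hy0) (radialCutoff_eq_zero hr hrLR (not_lt.1 hcon))
    exact hquiet (τ - 1) ⟨by linarith [hτ.1], by linarith [hτ.2, ht.2]⟩ y hy_gt.le hy_lt.le
  have hbud' : ∀ τ ∈ Ioo 0 t, eLpNorm ((Metric.ball (0 : EuclideanSpace ℝ (Fin 3)) R).indicator (u τ)) 3 volume ≤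
      ENNReal.ofReal b := fun τ hτ => hbud (τ - 1) ⟨by linarith [hτ.1], by linarith [hτ.2, ht.2]⟩
  -- the defect as two commutators
  have hdef : ∀ x, mildDefect (fun t x => radialCutoff r (r + L) x • v (t - 1) x) t x =
      (χ x • heatFlow (v (0 - 1)) t x - heatFlow (fun y => χ y • v (0 - 1) y) t x) -
        (χ x • oseenDuhamel 1 0 u u t x - oseenDuhamel 1 0 (fun τ y => χ y • u τ y) (fun τ y => χ y • u τ y) t x) :=
    fun x => mildDefect_cutRef_eq hv r (r + L) ht0 ht1 x
  -- the initial slice `f = v(−1)`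
  have hf : Continuous (v (0 - 1)) := hv.continuous_slice (by norm_num)
  have hfM : ∀ z, ‖v (0 - 1) z‖ ≤ M := by
    intro z
    have h := hv.norm_le (t := 0 - 1) (by norm_num) z
    rwa [show -((0 : ℝ) - 1) = 1 by norm_num, Real.sqrt_one, div_one] at h
  -- SUP BOUND
  have hsup_heat : ∀ x, ‖χ x • heatFlow (v (0 - 1)) t x - heatFlow (fun y => χ y • v (0 - 1) y) t x‖ ≤ C₁ * m₁ * (M / L) := by
    intro x
    have h := hheat r (r + L) hr hrLR (v (0 - 1)) M t hf hfM ht0 x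
    rw [show r + L - r = L by ring] at h
    refine h.trans ?_
    have ht12 : t ^ (1 / 2 : ℝ) ≤ 1 := Real.rpow_le_one ht0.le htle1 (by norm_num)
    have : 0 ≤ C₁ / L * M := by positivity
    calc C₁ / L * M * (2 * (2 : ℝ) ^ ((Module.finrank ℝ (EuclideanSpace ℝ (Fin 3)) : ℝ) / 2) * t ^ (1 / 2 : ℝ))
        = C₁ / L * M * m₁ * t ^ (1 / 2 : ℝ) := by rw [hm₁]; ring
      _ ≤ C₁ / L * M * m₁ * 1 := by gcongr
      _ = C₁ * m₁ * (M / L) := by ring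
  have hsup_oseen : ∀ x, ‖χ x • oseenDuhamel 1 0 u u t x -
      oseenDuhamel 1 0 (fun τ y => χ y • u τ y) (fun τ y => χ y • u τ y) t x‖ ≤
      C₀ * (C₁' ^ (1 / 2 : ℝ) * (M ^ 2 / ε * L ^ (-(1 / 2 : ℝ))) + ηc ^ 2) := by
    intro x
    have h := hOsup u χ t (C₁' / L) (M / Real.sqrt ε) ηc ht0 hχm hχ0 hχ1 (by positivity) hχLip hu_meas hA hηc hlayer x
    refine h.trans (mul_le_mul_of_nonneg_left ?_ hC₀.le)
    have ht34 : t ^ (3 / 4 : ℝ) ≤ 1 := Real.rpow_le_one ht0.le htle1 (by norm_num)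
    have ht12 : t ^ (1 / 2 : ℝ) ≤ 1 := Real.rpow_le_one ht0.le htle1 (by norm_num)
    have hA2 : (M / Real.sqrt ε) ^ 2 = M ^ 2 / ε := by rw [div_pow, Real.sq_sqrt hεpos.le]
    have hLχ : (C₁' / L) ^ (1 / 2 : ℝ) = C₁' ^ (1 / 2 : ℝ) * L ^ (-(1 / 2 : ℝ)) := by
      rw [Real.div_rpow hC₁'.le hL0.le, Real.rpow_neg hL0.le, div_eq_mul_inv]
    rw [hA2, hLχ]
    have h1 : 0 ≤ C₁' ^ (1 / 2 : ℝ) * L ^ (-(1 / 2 : ℝ)) * (M ^ 2 / ε) := by positivity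
    have h2 : 0 ≤ ηc ^ 2 := sq_nonneg _
    calc C₁' ^ (1 / 2 : ℝ) * L ^ (-(1 / 2 : ℝ)) * (M ^ 2 / ε) * t ^ (3 / 4 : ℝ) + ηc ^ 2 * t ^ (1 / 2 : ℝ)
        ≤ C₁' ^ (1 / 2 : ℝ) * L ^ (-(1 / 2 : ℝ)) * (M ^ 2 / ε) * 1 + ηc ^ 2 * 1 := by gcongr
      _ = C₁' ^ (1 / 2 : ℝ) * (M ^ 2 / ε * L ^ (-(1 / 2 : ℝ))) + ηc ^ 2 := by ring
  refine ⟨fun x => ?_, ?_⟩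
  · rw [hdef x]
    refine (norm_sub_le _ _).trans ((add_le_add (hsup_heat x) (hsup_oseen x)).trans ?_)
    have h1 : 0 ≤ M / L := by positivity
    have h2 : 0 ≤ M ^ 2 / ε * L ^ (-(1 / 2 : ℝ)) := by positivity
    have h3 : 0 ≤ ηc ^ 2 := sq_nonneg _
    calc C₁ * m₁ * (M / L) + C₀ * (C₁' ^ (1 / 2 : ℝ) * (M ^ 2 / ε * L ^ (-(1 / 2 : ℝ))) + ηc ^ 2)
        = (C₁ * m₁) * (M / L) + (C₀ * C₁' ^ (1 / 2 : ℝ)) * (M ^ 2 / ε * L ^ (-(1 / 2 : ℝ))) + C₀ * ηc ^ 2 := by ring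
      _ ≤ C * (M / L) + C * (M ^ 2 / ε * L ^ (-(1 / 2 : ℝ))) + C * ηc ^ 2 := by
          gcongr
      _ = C * (M / L + M ^ 2 / ε * L ^ (-(1 / 2 : ℝ)) + ηc ^ 2) := by ring
  · -- L³ BOUND
    have hheatL3 : eLpNorm (fun x => χ x • heatExtension (v (0 - 1)) t x -
        heatExtension (fun y => χ y • v (0 - 1) y) t x) 3 volume ≤
        2 * eLpNorm ((Metric.ball (0 : EuclideanSpace ℝ (Fin 3)) R).indicator (v (0 - 1))) 3 volume +
          ENNReal.ofReal (M * (2 * (2 : ℝ) ^ ((Module.finrank ℝ (EuclideanSpace ℝ (Fin 3)) : ℝ) / 2) * t ^ (1 / 2 : ℝ)) /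
              (R - (r + L))) * volume (Metric.closedBall (0 : EuclideanSpace ℝ (Fin 3)) (r + L)) ^ (1 / (3 : ℝ)) :=
      eLpNorm_heatCommutator_three_le hf hfM ht0 hr hL0 hRgt
    have hoseenL3 := hOL3 u χ t (C₁' / L) (M / Real.sqrt ε) M ηc (r + L) R b ht0 htle1 hχm hχ0 hχ1 (by positivity) hχLip
      hχρ hRgt hu_meas hA hM hshape hηc hlayer hb hbud'
    -- measurability of the two commutators
    have hm_heat : AEStronglyMeasurable (fun x => χ x • heatFlow (v (0 - 1)) t x - heatFlow (fun y => χ y • v (0 - 1) y) t x) volume := by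
      rw [heatFlow_of_pos _ ht0, heatFlow_of_pos _ ht0]
      have h1 : MemLp (v (0 - 1)) ⊤ volume := memLp_top_of_continuous_of_bound hf hfM
      have hχc : Continuous χ := (radialCutoff_contDiff r (r + L) (n := 0)).continuous
      have h2 : MemLp (fun y => χ y • v (0 - 1) y) ⊤ volume := by
        refine memLp_top_of_continuous_of_bound (hχc.smul hf) (C := M) fun z => ?_
        rw [norm_smul, Real.norm_eq_abs, abs_of_nonneg (hχ0 z)]
        exact (mul_le_of_le_one_left (norm_nonneg _) (hχ1 z)).trans (hfM z)
      exact ((hχc.aestronglyMeasurable).smul (memLp_heatExtension_holds h1 le_top ht0).aestronglyMeasurable).sub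
        (memLp_heatExtension_holds h2 le_top ht0).aestronglyMeasurable
    have hU : 0 ≤ M / Real.sqrt ε := by positivity
    have hχu_meas : AEStronglyMeasurable (uncurry fun τ y => χ y • u τ y) (volume.restrict (Ioo 0 t ×ˢ univ)) :=
      ((hχm.comp measurable_snd).aestronglyMeasurable).smul hu_meas
    have hχuA : ∀ τ ∈ Ioo 0 t, ∀ y, ‖χ y • u τ y‖ ≤ M / Real.sqrt ε := fun τ hτ y => by
      rw [norm_smul, Real.norm_eq_abs, abs_of_nonneg (hχ0 y)]
      exact (mul_le_of_le_one_left (norm_nonneg _) (hχ1 y)).trans (hA τ hτ y)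
    have hm_oseen : AEStronglyMeasurable (fun x => χ x • oseenDuhamel 1 0 u u t x -
        oseenDuhamel 1 0 (fun τ y => χ y • u τ y) (fun τ y => χ y • u τ y) t x) volume := by
      have h1 := aestronglyMeasurable_oseenDuhamel_of_bound one_pos ht0.le hu_meas hu_meas hA hA hU hU
      have h2 := aestronglyMeasurable_oseenDuhamel_of_bound one_pos ht0.le hχu_meas hχu_meas hχuA hχuA hU hU
      exact (((radialCutoff_contDiff r (r + L) (n := 0)).continuous.aestronglyMeasurable).smul h1).sub h2
    have hfun : mildDefect (fun t x => radialCutoff r (r + L) x • v (t - 1) x) t =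
        (fun x => χ x • heatFlow (v (0 - 1)) t x - heatFlow (fun y => χ y • v (0 - 1) y) t x) -
          fun x => χ x • oseenDuhamel 1 0 u u t x - oseenDuhamel 1 0 (fun τ y => χ y • u τ y) (fun τ y => χ y • u τ y) t x := by
      funext x; simp only [Pi.sub_apply]; exact hdef x
    rw [hfun]
    refine (eLpNorm_sub_le hm_heat hm_oseen (by norm_num)).trans ?_
    -- the heat half: `2b + M m₁/(R−r−L)·|B̄(r+L)|^{1/3} ≤ 2b + M m₁ vC`
    have hheat' : eLpNorm (fun x => χ x • heatFlow (v (0 - 1)) t x - heatFlow (fun y => χ y • v (0 - 1) y) t x) 3 volume ≤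
        ENNReal.ofReal (2 * b + M * m₁ * vC) := by
      rw [heatFlow_of_pos _ ht0, heatFlow_of_pos _ ht0]
      refine le_trans hheatL3 ?_
      have hb1 : eLpNorm ((Metric.ball (0 : EuclideanSpace ℝ (Fin 3)) R).indicator (v (0 - 1))) 3 volume ≤ ENNReal.ofReal b :=
        hbud (0 - 1) ⟨by norm_num, by norm_num; linarith⟩
      have hvol : volume (Metric.closedBall (0 : EuclideanSpace ℝ (Fin 3)) (r + L)) ^ (1 / (3 : ℝ)) =
          ENNReal.ofReal (r + L) * ENNReal.ofReal vC := by
        rw [Measure.addHaar_closedBall _ _ hrL.le, finrank_euclideanSpace_fin, ENNReal.mul_rpow_of_nonneg _ _ (by norm_num), hvC,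
          ENNReal.ofReal_toReal (ENNReal.rpow_ne_top_of_nonneg (by norm_num) measure_ball_lt_top.ne)]
        congr 1
        rw [ENNReal.ofReal_rpow_of_nonneg (by positivity) (by norm_num), ← Real.rpow_natCast, ← Real.rpow_mul hrL.le]
        norm_num
      rw [hvol]
      have htail : M * (2 * (2 : ℝ) ^ ((Module.finrank ℝ (EuclideanSpace ℝ (Fin 3)) : ℝ) / 2) * t ^ (1 / 2 : ℝ)) / (R - (r + L)) *
          (r + L) * vC ≤ M * m₁ * vC := by
        have ht12 : t ^ (1 / 2 : ℝ) ≤ 1 := Real.rpow_le_one ht0.le htle1 (by norm_num)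
        have hq : (r + L) / (R - (r + L)) ≤ 1 := by
          rw [div_le_one hRgap_pos]
          exact le_trans (by nlinarith) hRgap
        calc M * (2 * (2 : ℝ) ^ ((Module.finrank ℝ (EuclideanSpace ℝ (Fin 3)) : ℝ) / 2) * t ^ (1 / 2 : ℝ)) / (R - (r + L)) * (r + L) * vC
            = M * m₁ * t ^ (1 / 2 : ℝ) * ((r + L) / (R - (r + L))) * vC := by rw [hm₁]; field_simp
          _ ≤ M * m₁ * 1 * 1 * vC := by gcongr
          _ = M * m₁ * vC := by ring
      have hn : 0 ≤ M * (2 * (2 : ℝ) ^ ((Module.finrank ℝ (EuclideanSpace ℝ (Fin 3)) : ℝ) / 2) * t ^ (1 / 2 : ℝ)) / (R - (r + L)) := by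
        positivity
      calc 2 * eLpNorm ((Metric.ball (0 : EuclideanSpace ℝ (Fin 3)) R).indicator (v (0 - 1))) 3 volume +
            ENNReal.ofReal (M * (2 * (2 : ℝ) ^ ((Module.finrank ℝ (EuclideanSpace ℝ (Fin 3)) : ℝ) / 2) * t ^ (1 / 2 : ℝ)) /
              (R - (r + L))) * (ENNReal.ofReal (r + L) * ENNReal.ofReal vC)
          ≤ 2 * ENNReal.ofReal b + ENNReal.ofReal (M * m₁ * vC) := by
            refine add_le_add (mul_le_mul' le_rfl hb1) ?_
            rw [← ENNReal.ofReal_mul hrL.le, ← ENNReal.ofReal_mul hn, ← mul_assoc]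
            exact ENNReal.ofReal_le_ofReal htail
        _ = ENNReal.ofReal (2 * b + M * m₁ * vC) := by
            rw [ENNReal.ofReal_add (by positivity) (mul_nonneg (mul_nonneg hM hm₁pos.le) hvC0), ENNReal.ofReal_mul zero_le_two]
            norm_num
    -- the Oseen half: `C₀'((C₁'/L)^{1/2} M b + ηc b) + C_K (M²/ε)(4π/(R−(r+L))) t |B(r+L)|^{1/3} ≤ C₀'(C₁'^{1/2} M b + ηc b) + C_K 4π vB M²/(εΛ)`
    have hoseen' : eLpNorm (fun x => χ x • oseenDuhamel 1 0 u u t x -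
        oseenDuhamel 1 0 (fun τ y => χ y • u τ y) (fun τ y => χ y • u τ y) t x) 3 volume ≤
        ENNReal.ofReal (C₀' * (C₁' ^ (1 / 2 : ℝ) * M * b + ηc * b) + CK * 4 * Real.pi * vB * (M ^ 2 / (ε * Λ))) := by
      refine hoseenL3.trans ?_
      have hvol : volume (Metric.ball (0 : EuclideanSpace ℝ (Fin 3)) (r + L)) ^ (1 / (3 : ℝ)) =
          ENNReal.ofReal (r + L) * ENNReal.ofReal vB := by
        rw [Measure.addHaar_ball_of_pos _ _ hrL, finrank_euclideanSpace_fin, ENNReal.mul_rpow_of_nonneg _ _ (by norm_num), hvB,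
          ENNReal.ofReal_toReal (ENNReal.rpow_ne_top_of_nonneg (by norm_num) measure_ball_lt_top.ne)]
        congr 1
        rw [ENNReal.ofReal_rpow_of_nonneg (by positivity) (by norm_num), ← Real.rpow_natCast, ← Real.rpow_mul hrL.le]
        norm_num
      rw [hvol]
      have hLh : (C₁' / L) ^ (1 / 2 : ℝ) ≤ C₁' ^ (1 / 2 : ℝ) := by
        rw [Real.div_rpow hC₁'.le hL0.le]
        exact div_le_self hC₁'h (Real.one_le_rpow hL (by norm_num))
      have h1 : C₀' * ((C₁' / L) ^ (1 / 2 : ℝ) * M * b + ηc * b) ≤ C₀' * (C₁' ^ (1 / 2 : ℝ) * M * b + ηc * b) := by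
        gcongr
      have hA2 : (M / Real.sqrt ε) ^ 2 = M ^ 2 / ε := by rw [div_pow, Real.sq_sqrt hεpos.le]
      have hfar_real : CK * (M / Real.sqrt ε) ^ 2 * (4 * Real.pi / (R - (r + L))) * t * (r + L) * vB ≤
          CK * 4 * Real.pi * vB * (M ^ 2 / (ε * Λ)) := by
        rw [hA2]
        have hq : (r + L) / (R - (r + L)) ≤ 1 / Λ := by
          rw [div_le_div_iff₀ hRgap_pos (by positivity)]
          calc (r + L) * Λ = Λ * (r + L) * 1 := by ring
            _ ≤ Λ * (r + L) * (r + L) := by gcongr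
            _ = Λ * (r + L) ^ 2 := by ring
            _ ≤ R - (r + L) := hRgap
            _ = 1 * (R - (r + L)) := (one_mul _).symm
        calc CK * (M ^ 2 / ε) * (4 * Real.pi / (R - (r + L))) * t * (r + L) * vB
            = CK * 4 * Real.pi * vB * (M ^ 2 / ε) * t * ((r + L) / (R - (r + L))) := by field_simp
          _ ≤ CK * 4 * Real.pi * vB * (M ^ 2 / ε) * 1 * (1 / Λ) := by gcongr
          _ = CK * 4 * Real.pi * vB * (M ^ 2 / (ε * Λ)) := by field_simp
      have hn1 : 0 ≤ C₀' * ((C₁' / L) ^ (1 / 2 : ℝ) * M * b + ηc * b) := by positivity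
      have hn2 : 0 ≤ CK * (M / Real.sqrt ε) ^ 2 * (4 * Real.pi / (R - (r + L))) * t := by positivity
      calc ENNReal.ofReal (C₀' * ((C₁' / L) ^ (1 / 2 : ℝ) * M * b + ηc * b)) +
            ENNReal.ofReal (CK * (M / Real.sqrt ε) ^ 2 * (4 * Real.pi / (R - (r + L))) * t) * (ENNReal.ofReal (r + L) * ENNReal.ofReal vB)
          = ENNReal.ofReal (C₀' * ((C₁' / L) ^ (1 / 2 : ℝ) * M * b + ηc * b)) +
            ENNReal.ofReal (CK * (M / Real.sqrt ε) ^ 2 * (4 * Real.pi / (R - (r + L))) * t * (r + L) * vB) := by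
            rw [← ENNReal.ofReal_mul hrL.le, ← ENNReal.ofReal_mul hn2, ← mul_assoc]
        _ ≤ ENNReal.ofReal (C₀' * (C₁' ^ (1 / 2 : ℝ) * M * b + ηc * b)) + ENNReal.ofReal (CK * 4 * Real.pi * vB * (M ^ 2 / (ε * Λ))) :=
            add_le_add (ENNReal.ofReal_le_ofReal h1) (ENNReal.ofReal_le_ofReal hfar_real)
        _ = _ := (ENNReal.ofReal_add (by positivity) (mul_nonneg hne (by positivity))).symm
    refine (add_le_add hheat' hoseen').trans ?_
    have hnA : 0 ≤ 2 * b + M * m₁ * vC := add_nonneg (by positivity) (mul_nonneg (mul_nonneg hM hm₁pos.le) hvC0)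
    have hnB : 0 ≤ C₀' * (C₁' ^ (1 / 2 : ℝ) * M * b + ηc * b) + CK * 4 * Real.pi * vB * (M ^ 2 / (ε * Λ)) :=
      add_nonneg (mul_nonneg hC₀'.le (add_nonneg (by positivity) (by positivity))) (mul_nonneg hne (by positivity))
    rw [← ENNReal.ofReal_add hnA hnB]
    refine ENNReal.ofReal_le_ofReal ?_
    have h1 : 0 ≤ b := hb
    have h2 : 0 ≤ M * b := by positivity
    have h3 : 0 ≤ ηc * b := by positivity
    have h4 : 0 ≤ M ^ 2 / (ε * Λ) := by positivity
    calc 2 * b + M * m₁ * vC + (C₀' * (C₁' ^ (1 / 2 : ℝ) * M * b + ηc * b) + CK * 4 * Real.pi * vB * (M ^ 2 / (ε * Λ)))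
        = 2 * b + (m₁ * vC) * M + (C₀' * C₁' ^ (1 / 2 : ℝ)) * (M * b) + C₀' * (ηc * b) + (CK * 4 * Real.pi * vB) * (M ^ 2 / (ε * Λ)) := by
          ring
      _ ≤ C * b + C * M + C * (M * b) + C * (ηc * b) + C * (M ^ 2 / (ε * Λ)) := by gcongr
      _ = C * ((M + 1) * b + ηc * b + M + M ^ 2 / (ε * Λ)) := by ring

end Summit.NavierStokesRegularity.NavierStokesRegularity.Cruxes.TypeIQuantSubcubicExp.QuietCollar

end
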